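import Summits.AtomisticToContinuum.BoseEinsteinCondensation.Theorems.BECHeatBathGapJastrowDobrushinRungModelDobrushin
import Literature.MathematicalPhysics.QuantumManyBody.BoseGasBoxModeNested

/-!
# Crux `ParticleTensorisation` (stmt-AtomisticToContinuum-14367) — `Negative/`:
# from a weighted Poincaré inequality to the stub's amplitude clause (file H)

Toward `¬ stub_posdefDressing`: an abstract conversion. If a weight `w ∈ [0,1]` on `Λ₃^N`
(measurable, bounded below by `w_min > 0` on its support) satisfies the weighted real approximate
tensorisation `∫ (F - c₀)² w ≤ C₁ ∑_j ∫ (F - g_j)² w` for the normalised box product measure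
(bounded measurable real `F`, bounded measurable predictors `g_j` blind to `x_j`), then the
amplitude `A = √w · e^{-E/2}` satisfies the HYPOTHESIS clause of `stub_posdefDressing` at box side
`3` with the same constant `C₁ ≥ 1`, for EVERY measurable "energy" `E`:
`∃ c, ∫_{Λ^N} |F - c A e^{E/2}|² ≤ C₁ ∑_i ∫_{Λ^N} |F - g_i A e^{E/2}|²` for bounded measurable
complex `F, g_i` — because `A e^{E/2} = √w` exactly, `F = f √w` with `f = F/√w` bounded on the
support of `w`, the zero set of `w` contributes `∫ |F|²` to the left and `N ∫ |F|²` to the right,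
and Lebesgue measure on `Λ₃^N` is `27^N` times the product measure. No definitions.
-/

noncomputable section

namespace Summit.AtomisticToContinuum.BoseEinsteinCondensation.Theorems.PosdefDressingNeg

open MeasureTheory Function Finset Set JastrowDobrushin
open scoped ENNReal
open Literature.MathematicalPhysics.QuantumManyBody.BoseGas

variable {N : ℕ}

/-- `|√w e^{-E/2}|`-type amplitudes recombine: `(√w e^{-E/2}) e^{E/2} = √w`. [folklore] -/
theorem amplitude_mul_exp {w E : (Fin N → Space) → ℝ} {A : (Fin N → Space) → ℂ}
    (hA : ∀ X, A X = ((Real.sqrt (w X) * Real.exp (-(E X) / 2) : ℝ) : ℂ)) (X : Fin N → Space) :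
    A X * (Real.exp (E X / 2) : ℂ) = (Real.sqrt (w X) : ℂ) := by
  rw [hA, ← Complex.ofReal_mul, mul_assoc, ← Real.exp_add, show -(E X) / 2 + E X / 2 = 0 by ring,
    Real.exp_zero, mul_one]

/-- **From the weighted Poincaré inequality to the amplitude clause.** See the module docstring.
[folklore] -/
theorem amplitude_clause_of_weighted_AT (hN : 0 < N) {uL : Measure Space}
    (huL : uL = (ENNReal.ofReal ((3 : ℝ) ^ 3))⁻¹ • volume.restrict (box 3))
    {w : (Fin N → Space) → ℝ} (hwm : Measurable w) (hw01 : ∀ X, 0 ≤ w X ∧ w X ≤ 1)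
    {wmin : ℝ} (hwmin : 0 < wmin) (hwlow : ∀ X, w X ≠ 0 → wmin ≤ w X)
    {C₁ : ℝ} (hC₁ : 1 ≤ C₁)
    (hAT : ∀ (Fr : (Fin N → Space) → ℝ) (gr : Fin N → (Fin N → Space) → ℝ) (Mb : ℝ),
      Measurable Fr → (∀ X, |Fr X| ≤ Mb) → (∀ j, Measurable (gr j)) → (∀ j X, |gr j X| ≤ Mb) →
      (∀ j X y, gr j (update X j y) = gr j X) →
      ∫ X, (Fr X - (∫ Y, Fr Y * w Y ∂(Measure.pi fun _ => uL)) /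
          (∫ Y, w Y ∂(Measure.pi fun _ => uL))) ^ 2 * w X ∂(Measure.pi fun _ => uL) ≤
        C₁ * ∑ j, ∫ X, (Fr X - gr j X) ^ 2 * w X ∂(Measure.pi fun _ => uL))
    (E : (Fin N → Space) → ℝ) {A : (Fin N → Space) → ℂ}
    (hA : ∀ X, A X = ((Real.sqrt (w X) * Real.exp (-(E X) / 2) : ℝ) : ℂ)) :
    ∀ (F : (Fin N → Space) → ℂ) (g : Fin N → (Fin N → Space) → ℂ), Measurable F →
      (∀ i, Measurable (g i)) → (∃ Mb : ℝ, ∀ X, ‖F X‖ ≤ Mb ∧ ∀ i, ‖g i X‖ ≤ Mb) →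
      (∀ i X x, g i (update X i x) = g i X) →
      ∃ c : ℂ, (∫⁻ X in boxN N 3, (‖F X - c * (A X * (Real.exp (E X / 2) : ℂ))‖₊ : ℝ≥0∞) ^ 2) ≤
        ENNReal.ofReal C₁ * ∑ i : Fin N, ∫⁻ X in boxN N 3,
          (‖F X - g i X * (A X * (Real.exp (E X / 2) : ℂ))‖₊ : ℝ≥0∞) ^ 2 := by
  intro F g hFm hgm hbd hupd
  obtain ⟨Mb, hMb⟩ := hbd
  haveI : IsProbabilityMeasure uL := huL ▸ isProbabilityMeasure_boxMeasure (by norm_num)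
  haveI : Nonempty (Fin N) := ⟨⟨0, hN⟩⟩
  set ν : Measure (Fin N → Space) := Measure.pi fun _ : Fin N => uL with hν
  simp_rw [amplitude_mul_exp hA]
  have hMb0 : 0 ≤ Mb := (norm_nonneg _).trans (hMb (Classical.arbitrary _)).1
  -- the observable `f = F / √w` (zero where `w = 0`)
  set f : (Fin N → Space) → ℂ := fun X => F X * (((Real.sqrt (w X))⁻¹ : ℝ) : ℂ) with hf
  have hfm : Measurable f := hFm.mul (Complex.measurable_ofReal.comp (hwm.sqrt.inv))
  set Mf : ℝ := Mb * (Real.sqrt wmin)⁻¹ + Mb with hMf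
  have hswmin : 0 < Real.sqrt wmin := Real.sqrt_pos.mpr hwmin
  have hfb : ∀ X, ‖f X‖ ≤ Mf := by
    intro X
    rw [hf]
    simp only
    rw [norm_mul, Complex.norm_real, Real.norm_eq_abs]
    by_cases h0 : w X = 0
    · rw [h0, Real.sqrt_zero, inv_zero, abs_zero, mul_zero, hMf]
      positivity
    · have hle : (Real.sqrt (w X))⁻¹ ≤ (Real.sqrt wmin)⁻¹ := by
        rw [inv_le_inv₀ (Real.sqrt_pos.mpr (lt_of_le_of_ne (hw01 X).1 (Ne.symm h0))) hswmin]
        exact Real.sqrt_le_sqrt (hwlow X h0)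
      rw [abs_of_nonneg (inv_nonneg.mpr (Real.sqrt_nonneg _)), hMf]
      calc ‖F X‖ * (Real.sqrt (w X))⁻¹ ≤ Mb * (Real.sqrt wmin)⁻¹ :=
            mul_le_mul (hMb X).1 hle (inv_nonneg.mpr (Real.sqrt_nonneg _)) hMb0
        _ ≤ Mb * (Real.sqrt wmin)⁻¹ + Mb := by linarith
  have hgb : ∀ i X, ‖g i X‖ ≤ Mf := fun i X => by
    rw [hMf]
    have := (hMb X).2 i
    have : 0 ≤ Mb * (Real.sqrt wmin)⁻¹ := by positivity
    linarith
  have hMf0 : 0 ≤ Mf := (norm_nonneg _).trans (hfb (Classical.arbitrary _))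
  -- `F = f √w` on `{w ≠ 0}`
  have hFf : ∀ X, w X ≠ 0 → F X = f X * (Real.sqrt (w X) : ℂ) := by
    intro X h0
    have hs0 : Real.sqrt (w X) ≠ 0 :=
      (Real.sqrt_pos.mpr (lt_of_le_of_ne (hw01 X).1 (Ne.symm h0))).ne'
    rw [hf]
    simp only
    rw [mul_assoc, ← Complex.ofReal_mul, inv_mul_cancel₀ hs0, Complex.ofReal_one, mul_one]
  -- the real-valued theorem, for real and imaginary parts
  have h1 := hAT (fun X => (f X).re) (fun i X => (g i X).re) Mf (Complex.measurable_re.comp hfm)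
    (fun X => (Complex.abs_re_le_norm _).trans (hfb X))
    (fun i => Complex.measurable_re.comp (hgm i))
    (fun i X => (Complex.abs_re_le_norm _).trans (hgb i X)) (fun i X y => by simp only [hupd])
  have h2 := hAT (fun X => (f X).im) (fun i X => (g i X).im) Mf (Complex.measurable_im.comp hfm)
    (fun X => (Complex.abs_im_le_norm _).trans (hfb X))
    (fun i => Complex.measurable_im.comp (hgm i))
    (fun i X => (Complex.abs_im_le_norm _).trans (hgb i X)) (fun i X y => by simp only [hupd])
  set c₁ : ℝ := (∫ Y, (f Y).re * w Y ∂ν) / (∫ Y, w Y ∂ν) with hc₁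
  set c₂ : ℝ := (∫ Y, (f Y).im * w Y ∂ν) / (∫ Y, w Y ∂ν) with hc₂
  refine ⟨⟨c₁, c₂⟩, ?_⟩
  -- the complex weighted inequality for Bochner integrals against `ν`
  set K : ℝ := Mf + (|c₁| + |c₂| + Mf) with hK
  have iR : ∀ (G : (Fin N → Space) → ℝ), Measurable G → (∀ X, |G X| ≤ K) →
      Integrable (fun X => G X ^ 2 * w X) ν := fun G hGm hGb =>
    integrable_mul_w (hGm.pow_const 2) (C := K ^ 2) (fun X => by
      rw [abs_pow]; exact pow_le_pow_left₀ (abs_nonneg _) (hGb X) 2) hwm hw01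
  have hreal : ∫ X, ‖f X - ⟨c₁, c₂⟩‖ ^ 2 * w X ∂ν ≤
      C₁ * ∑ i, ∫ X, ‖f X - g i X‖ ^ 2 * w X ∂ν := by
    have e1 : (fun X => ‖f X - ⟨c₁, c₂⟩‖ ^ 2 * w X) =
        fun X => ((f X).re - c₁) ^ 2 * w X + ((f X).im - c₂) ^ 2 * w X := by
      funext X
      rw [Complex.sq_norm, Complex.normSq_apply, Complex.sub_re, Complex.sub_im]
      ring
    have e2 : ∀ i, (fun X => ‖f X - g i X‖ ^ 2 * w X) =
        fun X => ((f X).re - (g i X).re) ^ 2 * w X + ((f X).im - (g i X).im) ^ 2 * w X := by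
      intro i; funext X
      rw [Complex.sq_norm, Complex.normSq_apply, Complex.sub_re, Complex.sub_im]
      ring
    rw [e1, integral_add]
    rotate_left
    · exact iR _ ((Complex.measurable_re.comp hfm).sub measurable_const) fun X =>
        (abs_sub _ _).trans (add_le_add ((Complex.abs_re_le_norm _).trans (hfb X))
          (by linarith [abs_nonneg c₂, hMf0]))
    · exact iR _ ((Complex.measurable_im.comp hfm).sub measurable_const) fun X =>
        (abs_sub _ _).trans (add_le_add ((Complex.abs_im_le_norm _).trans (hfb X))
          (by linarith [abs_nonneg c₁, hMf0]))
    have e3 : ∀ i, ∫ X, ‖f X - g i X‖ ^ 2 * w X ∂ν =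
        ∫ X, ((f X).re - (g i X).re) ^ 2 * w X ∂ν +
          ∫ X, ((f X).im - (g i X).im) ^ 2 * w X ∂ν := by
      intro i
      rw [e2 i, integral_add]
      · exact iR _ ((Complex.measurable_re.comp hfm).sub (Complex.measurable_re.comp (hgm i)))
          fun X => (abs_sub _ _).trans (add_le_add ((Complex.abs_re_le_norm _).trans (hfb X))
            (by linarith [abs_nonneg c₁, abs_nonneg c₂,
              (Complex.abs_re_le_norm _).trans (hgb i X)]))
      · exact iR _ ((Complex.measurable_im.comp hfm).sub (Complex.measurable_im.comp (hgm i)))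
          fun X => (abs_sub _ _).trans (add_le_add ((Complex.abs_im_le_norm _).trans (hfb X))
            (by linarith [abs_nonneg c₁, abs_nonneg c₂,
              (Complex.abs_im_le_norm _).trans (hgb i X)]))
    simp_rw [e3]
    rw [Finset.sum_add_distrib, mul_add]
    exact add_le_add h1 h2
  -- conversion of the weighted integrals to lower Lebesgue integrals over `Λ₃^N`
  have hb1 : ∀ X, ‖f X - ⟨c₁, c₂⟩‖ ≤ K := fun X =>
    (norm_sub_le _ _).trans (add_le_add (hfb X) (by
      have := Complex.norm_le_abs_re_add_abs_im (⟨c₁, c₂⟩ : ℂ)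
      simp only at this
      linarith))
  have hb2 : ∀ i X, ‖f X - g i X‖ ≤ K := fun i X =>
    (norm_sub_le _ _).trans (add_le_add (hfb X) (by
      linarith [hgb i X, abs_nonneg c₁, abs_nonneg c₂]))
  have hL : (0 : ℝ) < 3 := by norm_num
  have hconv : ∀ (G : (Fin N → Space) → ℂ), Measurable G → (∀ X, ‖G X‖ ≤ K) →
      ∫⁻ X in boxN N 3, (‖G X‖₊ : ℝ≥0∞) ^ 2 * ENNReal.ofReal (w X) =
        (ENNReal.ofReal ((3 : ℝ) ^ 3)) ^ N * ENNReal.ofReal (∫ X, ‖G X‖ ^ 2 * w X ∂ν) := by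
    intro G hGm hGb
    rw [volume_restrict_boxN_eq_smul_pi hL N, lintegral_smul_measure, smul_eq_mul, ← huL, ← hν,
      lintegral_nnnorm_sq_mul_eq hGm hGb hwm hw01]
  -- the pointwise bookkeeping on `{w = 0}`
  set Z : Set (Fin N → Space) := {X | w X = 0} with hZ
  have hZm : MeasurableSet Z := hwm (measurableSet_singleton 0)
  have hpt : ∀ (m : (Fin N → Space) → ℂ) (X : Fin N → Space),
      (‖F X - m X * (Real.sqrt (w X) : ℂ)‖₊ : ℝ≥0∞) ^ 2 =
        (‖f X - m X‖₊ : ℝ≥0∞) ^ 2 * ENNReal.ofReal (w X) +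
          Z.indicator (fun X => (‖F X‖₊ : ℝ≥0∞) ^ 2) X := by
    intro m X
    by_cases h0 : w X = 0
    · rw [Set.indicator_of_mem (show X ∈ Z from h0), h0, Real.sqrt_zero, Complex.ofReal_zero,
        mul_zero, sub_zero, ENNReal.ofReal_zero, mul_zero, zero_add]
    · rw [Set.indicator_of_notMem (show X ∉ Z from h0), add_zero, hFf X h0, ← sub_mul, nnnorm_mul,
        ENNReal.coe_mul, mul_pow, ennnorm_ofReal_sqrt_sq (hw01 X).1]
  set R : ℝ≥0∞ := ∫⁻ X in boxN N 3, Z.indicator (fun X => (‖F X‖₊ : ℝ≥0∞) ^ 2) X with hR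
  have hint : ∀ (m : (Fin N → Space) → ℂ), Measurable m →
      ∫⁻ X in boxN N 3, (‖F X - m X * (Real.sqrt (w X) : ℂ)‖₊ : ℝ≥0∞) ^ 2 =
        (∫⁻ X in boxN N 3, (‖f X - m X‖₊ : ℝ≥0∞) ^ 2 * ENNReal.ofReal (w X)) + R := by
    intro m hm
    have hmeas : Measurable fun X => (‖f X - m X‖₊ : ℝ≥0∞) ^ 2 * ENNReal.ofReal (w X) :=
      (((hfm.sub hm).nnnorm.coe_nnreal_ennreal).pow_const 2).mul hwm.ennreal_ofReal
    simp_rw [hpt m]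
    rw [hR, lintegral_add_left hmeas]
  -- assemble
  set K27 : ℝ≥0∞ := (ENNReal.ofReal ((3 : ℝ) ^ 3)) ^ N with hK27
  have hnn : ∀ i, 0 ≤ ∫ X, ‖f X - g i X‖ ^ 2 * w X ∂ν := fun i =>
    integral_nonneg fun X => mul_nonneg (sq_nonneg _) (hw01 X).1
  have hC₁' : (1 : ℝ≥0∞) ≤ ENNReal.ofReal C₁ := by
    rw [← ENNReal.ofReal_one]; exact ENNReal.ofReal_le_ofReal hC₁
  have hNR : R ≤ (N : ℝ≥0∞) * R := le_mul_of_one_le_left (zero_le) (by exact_mod_cast hN)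
  calc ∫⁻ X in boxN N 3, (‖F X - (⟨c₁, c₂⟩ : ℂ) * (Real.sqrt (w X) : ℂ)‖₊ : ℝ≥0∞) ^ 2
      = (∫⁻ X in boxN N 3, (‖f X - ⟨c₁, c₂⟩‖₊ : ℝ≥0∞) ^ 2 * ENNReal.ofReal (w X)) + R :=
        hint (fun _ => ⟨c₁, c₂⟩) measurable_const
    _ = K27 * ENNReal.ofReal (∫ X, ‖f X - ⟨c₁, c₂⟩‖ ^ 2 * w X ∂ν) + R := by
        rw [hconv (fun X => f X - ⟨c₁, c₂⟩) (hfm.sub_const _) hb1]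
    _ ≤ K27 * ENNReal.ofReal (C₁ * ∑ i, ∫ X, ‖f X - g i X‖ ^ 2 * w X ∂ν) + (N : ℝ≥0∞) * R :=
        add_le_add (mul_le_mul_of_nonneg_left (ENNReal.ofReal_le_ofReal hreal) (zero_le)) hNR
    _ ≤ ENNReal.ofReal C₁ * ∑ i, (K27 * ENNReal.ofReal (∫ X, ‖f X - g i X‖ ^ 2 * w X ∂ν) + R) := by
        have eq1 : K27 * ENNReal.ofReal (C₁ * ∑ i, ∫ X, ‖f X - g i X‖ ^ 2 * w X ∂ν) =
            ENNReal.ofReal C₁ * ∑ i, K27 * ENNReal.ofReal (∫ X, ‖f X - g i X‖ ^ 2 * w X ∂ν) := by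
          rw [ENNReal.ofReal_mul (by linarith), ENNReal.ofReal_sum_of_nonneg (fun i _ => hnn i),
            Finset.mul_sum, Finset.mul_sum, Finset.mul_sum]
          exact Finset.sum_congr rfl fun i _ => by ring
        rw [eq1, Finset.sum_add_distrib, mul_add]
        refine add_le_add le_rfl ?_
        rw [Finset.sum_const, Finset.card_univ, Fintype.card_fin, nsmul_eq_mul]
        exact le_mul_of_one_le_left (zero_le) hC₁'
    _ = ENNReal.ofReal C₁ * ∑ i, ∫⁻ X in boxN N 3,
          (‖F X - g i X * (Real.sqrt (w X) : ℂ)‖₊ : ℝ≥0∞) ^ 2 := by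
        congr 1
        refine Finset.sum_congr rfl fun i _ => ?_
        rw [hint (g i) (hgm i), hconv (fun X => f X - g i X) (hfm.sub (hgm i)) (hb2 i)]

end Summit.AtomisticToContinuum.BoseEinsteinCondensation.Theorems.PosdefDressingNeg

end
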